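import Summits.Schanuel.Schanuel.Theorems.RootDecomp1EMultiplierFieldDictionary

/-!
# RootDecomp1EMultiplierFieldGamma — part 4/4 of the port of lens-2 gen 12 «MULTIPLIER FIELD» (ROUND 12 of route-Schanuel-RootDecomp1E, THEOREM ROUND)

§4–§5: the output-3 Γ-engine (GammaRich ⟹ trdeg ≥ 3, mod the tree theorem `nesterenko` as binder hN) and `closes` calling the live RootDecomp1E.closes.

Port (census-1 gen 8) of HOME/decomp-schanuel-lens-2/g12/MultiplierField.lean (sha256 5884507d…, 910 l; critic VERDICT 2026-08-30T15:36:56Z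
ACCEPTED — PATH T, port CLEARED with hygiene h1–h4: the two unused simp arguments dropped; cell predicates are DEFINITIONS of this
decomposition (not cited facts); the tree theorems `smallTrdeg_thm_2_9_pos` / `nesterenko` stay explicit binders h29 / hN as in
RootDecomp1EEStableRung; `closes` kept, informational). Namespace `Summit.Schanuel.Schanuel.Theorems.RootDecomp1EMultiplierField` (node: …Theses.MultiplierField);
statements and proofs verbatim. `--supports stmt-Schanuel-31409` (EStableDefectOne, the CM type). Sorry-free; standard axioms.
Nothing here proves Schanuel; rung 0.
-/

set_option linter.dupNamespace false

namespace Summit.Schanuel.Schanuel.Theorems.RootDecomp1EMultiplierField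


open Complex IntermediateField Module Polynomial
open Summit.Schanuel.Schanuel.Theses.RootDecomp1E (DefectOneSchanuel EStableDefectOne PlainDefectOne
  ClosedFormAtomSchanuel AlgAnchoredDarkAtomSchanuel LineLogDarkAtomSchanuel DeepLogDarkAtomSchanuel
  OffAxisClosure FreeDarkAtomSchanuel)
open Summit.Schanuel.Schanuel.Theorems.RootDecomp1EAnchor (isAlgebraic_of_mem_adjoin trdeg_adjoin_le_of_isAlgebraic
  mem_adjoin_of_mem_span exp_isAlgebraic_of_mem_span trdeg_le_of_mem_span trdeg_eq_of_span_eq offAxisClosure_holds)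
open Summit.Schanuel.Schanuel.Theorems.RootDecomp1EEStableStructure (degree_dvd eStable_structure eStable_prime_isLine)
open Summit.Schanuel.Schanuel.Theorems.RootDecomp1EEStableRung (defectOne_of_le_two mul_mem_span_of_gens
  one_beta_linearIndependent two_le_trdeg_of_eStable_three)
open Summit.Schanuel.Schanuel.Theorems.RootDecomp1EDefectOneSplit (defectOneSchanuelGlue_holds)
open Summit.Schanuel.Schanuel.Theorems.RootDecomp1EModuleType (SubMinimalDefect)
open Summit.Schanuel.Schanuel.Theorems.RootDecomp1EModuleGrids (rat_mul_pi_eq_rat)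
open Summit.Schanuel.Schanuel.Theorems.RootDecomp1EMultiplicationTypeLeaves (defectOne_quarticLine_of_conj23
  two_le_trdeg_of_eStable sub_two_le_trdeg_of_subMinimal)
open Summit.Schanuel.Schanuel.Theorems.RootDecomp1ELevels (LWLevel le_trdeg_of_algebraicIndependent le_trdeg_of_lwLevel)
open Literature.Barriers.Schanuel (smallTrdeg_thm_2_9_pos WaldschmidtConjecture_2_3 isAlgebraic_I)
open Literature.NumberTheory.Transcendental (nesterenko transcendental_pi_holds algebraicIndependent_exp_holds)

noncomputable section

/-! ## §4 (E-R12 (c′)) THE OUTPUT-3 ENGINE: Nesterenko's triple `(π, e^π, Γ(1/4))` transported into `F_z` -/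

/-- `π, e^π, Γ(1/4) ∈ ℂ` are algebraically independent over `ℚ` (tree `nesterenko`, along `ℝ → ℂ`). -/
theorem algebraicIndependent_pi_expPi_gamma (hN : nesterenko) :
    AlgebraicIndependent ℚ ![(Real.pi : ℂ), cexp (Real.pi : ℂ), (Real.Gamma (1 / 4) : ℂ)] := by
  have e : (![(Real.pi : ℂ), cexp (Real.pi : ℂ), (Real.Gamma (1 / 4) : ℂ)] : Fin 3 → ℂ) =
      (Complex.ofRealAm.restrictScalars ℚ) ∘ ![Real.pi, Real.exp Real.pi, Real.Gamma (1 / 4)] := by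
    funext i; fin_cases i <;> simp [Complex.ofReal_exp]
  rw [e]
  exact AlgebraicIndependent.map' hN Complex.ofReal_injective

/-- **Γ-RICH**: `π`, `e^π` and `Γ(1/4)` are algebraic over `F_z = ℚ(z, e^z)`. -/
def GammaRich {ι : Type*} (z : ι → ℂ) : Prop :=
  IsAlgebraic ↥(adjoin ℚ (Set.range z ∪ Set.range (cexp ∘ z))) (Real.pi : ℂ) ∧
  IsAlgebraic ↥(adjoin ℚ (Set.range z ∪ Set.range (cexp ∘ z))) (cexp (Real.pi : ℂ)) ∧
  IsAlgebraic ↥(adjoin ℚ (Set.range z ∪ Set.range (cexp ∘ z))) (Real.Gamma (1 / 4) : ℂ)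

/-- **THE ENGINE: `GammaRich z ⟹ trdeg F_z ≥ 3`** — output `3`, one above every engine of rounds 7–11 at `n = 4`. -/
theorem three_le_trdeg_of_gammaRich (hN : nesterenko) {ι : Type*} {z : ι → ℂ} (h : GammaRich z) :
    (3 : Cardinal) ≤ Algebra.trdeg ℚ ↥(adjoin ℚ (Set.range z ∪ Set.range (cexp ∘ z))) := by
  obtain ⟨h1, h2, h3⟩ := h
  have hle : ((3 : ℕ) : Cardinal) ≤ Algebra.trdeg ℚ
      ↥(adjoin ℚ (Set.range ![(Real.pi : ℂ), cexp (Real.pi : ℂ), (Real.Gamma (1 / 4) : ℂ)])) :=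
    le_trdeg_of_algebraicIndependent (algebraicIndependent_pi_expPi_gamma hN) (fun j => subset_adjoin ℚ _ ⟨j, rfl⟩)
  refine (by simpa using hle : (3 : Cardinal) ≤ _).trans (trdeg_adjoin_le_of_isAlgebraic ?_)
  rintro x ⟨j, rfl⟩
  fin_cases j
  · simpa using h1
  · simpa using h2
  · simpa using h3

/-- **`S⁻` DECIDED ON Γ-RICH QUADRUPLES** (hypothesis-free given the tree theorem `nesterenko_holds`; PADDED for `S⁻`:
three of the four transcendentals are Nesterenko's). -/
theorem defectOne_four_of_gammaRich (hN : nesterenko) (z : Fin 4 → ℂ) (h : GammaRich z) :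
    ((4 : ℕ) : Cardinal) ≤ Algebra.trdeg ℚ ↥(adjoin ℚ (Set.range z ∪ Set.range (cexp ∘ z))) + 1 :=
  (four_le_add_one_iff _).mpr (three_le_trdeg_of_gammaRich hN h)

/-- **FULL SCHANUEL ON Γ-RICH TRIPLES** (`n = 3`, no defect). -/
theorem schanuel_three_of_gammaRich (hN : nesterenko) (z : Fin 3 → ℂ) (h : GammaRich z) :
    ((3 : ℕ) : Cardinal) ≤ Algebra.trdeg ℚ ↥(adjoin ℚ (Set.range z ∪ Set.range (cexp ∘ z))) := by
  simpa using three_le_trdeg_of_gammaRich hN h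

/-- **HORIZON**: from `n = 5` on the engine is INERT inside `S⁻` — first-failure locality alone already gives
`trdeg ≥ n − 2 ≥ 3` (tree `sub_two_le_trdeg_of_subMinimal`), which is all the engine says. -/
theorem three_le_trdeg_of_subMinimal_five {n : ℕ} (hn : 5 ≤ n) (z : Fin n → ℂ) (hz : LinearIndependent ℚ z)
    (hsub : SubMinimalDefect n z) :
    (3 : Cardinal) ≤ Algebra.trdeg ℚ ↥(adjoin ℚ (Set.range z ∪ Set.range (cexp ∘ z))) := by
  have h := sub_two_le_trdeg_of_subMinimal z hz hsub
  have h3 : ((3 : ℕ) : Cardinal.{0}) ≤ ((n - 2 : ℕ) : Cardinal.{0}) := Nat.cast_le.mpr (by omega)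
  exact (by simpa using h3 : (3 : Cardinal.{0}) ≤ _).trans h

/-- A Γ-RICH E-STABLE QUADRUPLE of UNKNOWN K-type: `Γquad = (π, πi, log Γ(1/4), i·log Γ(1/4))` (K-line iff
`log Γ(1/4)/π` is quadratic over `ℚ(i)`).  `S⁻`'s conclusion holds there by the engine, whatever the type. -/
def gammaQuad : Fin 4 → ℂ :=
  ![(Real.pi : ℂ), (Real.pi : ℂ) * I, (Real.log (Real.Gamma (1 / 4)) : ℂ), (Real.log (Real.Gamma (1 / 4)) : ℂ) * I]

/-- `GammaRich gammaQuad`. -/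
theorem gammaQuad_gammaRich : GammaRich gammaQuad := by
  have hΓ : cexp ((Real.log (Real.Gamma (1 / 4)) : ℂ)) = (Real.Gamma (1 / 4) : ℂ) := by
    rw [← Complex.ofReal_exp, Real.exp_log (Real.Gamma_pos_of_pos (by norm_num))]
  refine ⟨isAlgebraic_of_mem_adjoin (subset_adjoin ℚ _ (Or.inl ⟨0, rfl⟩)),
    isAlgebraic_of_mem_adjoin (subset_adjoin ℚ _ (Or.inr ⟨0, rfl⟩)), ?_⟩
  rw [← hΓ]
  exact isAlgebraic_of_mem_adjoin (subset_adjoin ℚ _ (Or.inr ⟨2, rfl⟩))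

/-- `S⁻` holds at the E-stable Γ-quadruple `gammaQuad = (π, πi, log Γ(1/4), i log Γ(1/4))` (mod the tree theorem `nesterenko`, binder `hN`). -/
theorem defectOne_at_gammaQuad (hN : nesterenko) :
    ((4 : ℕ) : Cardinal) ≤ Algebra.trdeg ℚ ↥(adjoin ℚ (Set.range gammaQuad ∪ Set.range (cexp ∘ gammaQuad))) + 1 :=
  defectOne_four_of_gammaRich hN gammaQuad gammaQuad_gammaRich

/-! ## §5 `closes`: the node's decomposition decides Schanuel, by CALLING the live `RootDecomp1E.closes` -/

/-- **closes.**  `S⁻`'s CM type cut by the multiplier degree (K-LINES ∧ K-MODULES), round 7's PLAIN residual, and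
rev 24's dark chain; `OffAxisClosure` (stmt-30101, CLOSED) is fed by its tree proof. -/
theorem closes (hKL : KLineDefectOne) (hKM : KModuleDefectOne) (hP : PlainDefectOne)
    (hC : ClosedFormAtomSchanuel) (hAlg : AlgAnchoredDarkAtomSchanuel) (hLine : LineLogDarkAtomSchanuel)
    (hDeep : DeepLogDarkAtomSchanuel) (hF : FreeDarkAtomSchanuel) : _root_.Schanuel :=
  Summit.Schanuel.Schanuel.Theses.RootDecomp1E.closes
    (defectOneSchanuelGlue_holds (eStableDefectOne_of_kline_kmodule hKL hKM) hP)
    hC hAlg hLine hDeep offAxisClosure_holds hF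

/-- Variant with the RAW Gel'fond family in place of the first-failure K-line cell. -/
theorem closes' (hG : GelfondLineDefectOne) (hKM : KModuleDefectOne) (hP : PlainDefectOne)
    (hC : ClosedFormAtomSchanuel) (hAlg : AlgAnchoredDarkAtomSchanuel) (hLine : LineLogDarkAtomSchanuel)
    (hDeep : DeepLogDarkAtomSchanuel) (hF : FreeDarkAtomSchanuel) : _root_.Schanuel :=
  closes (kLineDefectOne_of_gelfondLine hG) hKM hP hC hAlg hLine hDeep hF

end

end Summit.Schanuel.Schanuel.Theorems.RootDecomp1EMultiplierField
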